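import Summits.Ventures.CertifiedManyBodySolver.Rows.HalfFilledTLFreeControl
import Summits.Ventures.CertifiedManyBodySolver.Rows.HalfFilledTLTorus
import Literature.MathematicalPhysics.QuantumLattice.HartreeFockFreeFermionTorus
import Literature.MathematicalPhysics.QuantumLattice.HubbardTorusFreeFermionExactEnergy
import Literature.MathematicalPhysics.QuantumLattice.HubbardSquareFreeFermionEnergyDensity
import Literature.MathematicalPhysics.QuantumLattice.InfVolFermionStateDensity

/-!
# M2 rows, part 14 — the paramagnetic HARTREE–FOCK ENERGY CEILING `e(t,U,n) ≤ e(t,0,n) + U(n/2)²` and the certificate-free two-sided ENVELOPE of every TL `e₀` cell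

HONEST FRAMING: first certified bounds; not a superconductivity verdict; every number certified or
labelled float.  This file adds NO certified number.  It completes part 13 (the free FLOOR `-16/π²` at
every `U ≥ 0`) by the matching certificate-free CEILING: the plane-wave (paramagnetic Hartree–Fock)
Slater determinant — the free Fermi sea itself — is a trial state at every `U`, and its repulsion costs
exactly `U (N/2)²/|Λ|` (uniform density `n/2` per spin).  The tree already has both finite-torus halves
BY NAME: `HartreeFock.hubbardTorus_groundEnergyAt_le_freeFermion_momentum`
(`E_L(U, |S↑|+|S↓|) ≤ Σ_{S↑} ε + Σ_{S↓} ε + U |S↑||S↓|/L^d`, Bach–Lieb–Solovej eq. (2c.36)) and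
`FreeFermionTorus.hubbardTorus_groundEnergyAt_zero_eq_two_mul` (`E_L(0, 2|S|) = 2 Σ_S ε` for a Fermi sea `S`,
Lieb–Loss bathtub); a Fermi sea of any prescribed size exists (`exists_fermiSet`).  Comparing the two AT THE
SAME FINITE `L` and passing to the limit with the EXISTING thermodynamic limits at `U` and at `U = 0`
(`ThermodynamicLimit.tendsto_energyDensity2D_torus`, `tendsto_rectN_div_sq`) gives the textbook bound with the
SHARP Fermi sea and no Riemann sum of a discontinuous occupation (the route
`HartreeFock.energyDensity2D_le_freeFermion` takes continuous occupation profiles and reaches the sharp sea only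
as a limit of quadratures):

* §1 `groundEnergyAt_le_free_add_interaction` — every torus `(ℤ/Lℤ)^d`, `L ≥ 3`, every real `t, U`, every
  `m ≤ L^d`: `E_L(t, U, 2m) ≤ E_L(t, 0, 2m) + U m²/L^d`.
* §2 `energyDensity2D_le_free_add_interaction` — square lattice, `U ≥ 0`, `0 ≤ n < 2`:
  `e(t, U, n) ≤ e(t, 0, n) + U (n/2)²`; at half filling `e(t, U, 1) ≤ e(t, 0, 1) + U/4 = -16|t|/π² + U/4`.
* §3 the M2 row faces at `t = 1`: the THEOREM CEILING `M2EnergyUpperRow U hi` for every slot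
  `hi ≥ U/4 - 1.6211` (`-16/π² < -1.6211`), i.e. `-1.1211 / -0.6211 / -0.1211 / 0.3789` at `U = 2 / 4 / 6 / 8`;
  with part 13's floor the certificate-free ENVELOPE `M2EnergyRow U (-1.6212) (U/4 - 1.6211)` of every cell.
* §4 CONTROLS as refutations: a LOWER row at or above the ceiling slot is false
  (`not_m2EnergyLowerRow_of_hfSlot_le`; exact form `not_m2EnergyLowerRow_of_hf_lt`).
* §5 the `4 × 4` torus (the table's T4 cells): `E₀(4×4, t=1, U, N=16) ≤ -24 + 4U` for every real `U`
  (`FreeFermionTorus.hubbardTorus44_groundEnergyAt_one_zero_sixteen`: `E₀(U=0) = -24`), i.e.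
  `TorusEnergyUpperRow 4 U (-16 / -8 / 0 / 8)` at `U = 2 / 4 / 6 / 8`.

READING RULE (binding, as for part 11's kinematic endpoints and part 13's free floor): the ceiling
`-16/π² + U/4` is a THEOREM, certificate-free; it is never a "certified" endpoint, never enters an M2-width
verdict, the tightest-visible pool or a comparison, and a cell printed with it must label it "HF ceiling (thm)".
Unlike the floor it is NOT physically empty at weak coupling: at `U = 2` the slot `-1.1211` lies only `0.038`
above the table's certified ceiling of record (2026-08-21: `-1.1594207`, the plaquette-dressed Hartree–Fock
certificate #27 — its gain over the plain Fermi sea), at `U = 4 / 6 / 8` it is loose (`-0.6211 / -0.1211 /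
0.3789` vs the certified `-0.8326271 / -0.6271915 / -0.4963187`).  As a PIPELINE CONTROL it is two-sided with
part 13: a certified LOWER endpoint `≥ U/4 - 1.6211` is a CONTRADICTION (today's certified floors
`-1.2468015 / -0.9586321 / -0.7569758 / -0.6129339` clear it by `0.126 / 0.338 / 0.636 / 0.992`).
-/

namespace Summit.Ventures.CertifiedManyBodySolver

open Filter Topology
open Literature.MathematicalPhysics.QuantumLattice
open Literature.MathematicalPhysics.QuantumLattice.ThermodynamicLimit
open Literature.Probability.LatticeModels (TorusSite latticeMomentum)

namespace M2

/-! ## §1 Finite tori: the repulsion costs at most `U m²/L^d` on top of the free energy -/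

/-- **Plane-wave Hartree–Fock at finite volume.** On the torus `(ℤ/Lℤ)^d`, `L ≥ 3`, for every real
`t, U` and every `m ≤ L^d`: `E_L(t, U, 2m) ≤ E_L(t, 0, 2m) + U m²/L^d` — take a Fermi sea `S` of `m` momenta
(`exists_fermiSet`), fill it with both spins: its energy at coupling `U` is `2 Σ_S ε + U m²/L^d`
(`HartreeFock.hubbardTorus_groundEnergyAt_le_freeFermion_momentum`) and `2 Σ_S ε = E_L(t, 0, 2m)`
(`FreeFermionTorus.hubbardTorus_groundEnergyAt_zero_eq_two_mul`).  No sign condition on `U`.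
[cite: BachLiebSolovej1994, eq. (2c.36)] [cite: LiebLoss1993, §8, Theorem 8.2] -/
theorem groundEnergyAt_le_free_add_interaction {d L : ℕ} [NeZero L] (hL : 3 ≤ L) (t U : ℝ)
    {m : ℕ} (hm : m ≤ Fintype.card (TorusSite d L)) :
    groundEnergyAt (fermionTorusGraph d L) t U (2 * m) ≤
      groundEnergyAt (fermionTorusGraph d L) t 0 (2 * m) + U * ((m : ℝ) * m) / (L : ℝ) ^ d := by
  classical
  obtain ⟨S, eF, hS, hle, hge⟩ := exists_fermiSet
    (fun k : TorusSite d L => -(t * (2 * ∑ i, Real.cos (latticeMomentum L k i)))) hm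
  have h0 := FreeFermionTorus.hubbardTorus_groundEnergyAt_zero_eq_two_mul hL t eF S hle hge
  have hU' := HartreeFock.hubbardTorus_groundEnergyAt_le_freeFermion_momentum hL t U S S
  rw [hS, ← two_mul] at hU'
  rw [hS] at h0
  rw [h0]
  linarith

/-! ## §2 Thermodynamic limit on the square lattice -/

/-- **Paramagnetic Hartree–Fock ceiling with the sharp Fermi sea.** For `U ≥ 0` and `0 ≤ n < 2`:
`e(t, U, n) ≤ e(t, 0, n) + U (n/2)²` — §1 along the tori `L × L` in the sectors `N_L(n) = 2⌊nL²/2⌋`, divided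
by `L²`, and the limits `E_L(U, N_L)/L² → e(t,U,n)`, `E_L(0, N_L)/L² → e(t,0,n)`
(`tendsto_energyDensity2D_torus`; `U ≥ 0` is used only there) and `N_L/L² → n` (`tendsto_rectN_div_sq`).
[cite: BachLiebSolovej1994, eq. (2c.36)] [cite: LiebLoss1993, §8, Theorem 8.2] -/
theorem energyDensity2D_le_free_add_interaction (t : ℝ) {U : ℝ} (hU : 0 ≤ U) {n : ℝ}
    (hn0 : 0 ≤ n) (hn2 : n < 2) :
    energyDensity2D t U n ≤ energyDensity2D t 0 n + U * (n / 2) ^ 2 := by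
  set φ : ℕ → ℕ := fun m => m + 3 with hφdef
  have hφ : Tendsto φ atTop atTop :=
    tendsto_atTop_atTop.2 fun b => ⟨b, fun m hm => by simp only [hφdef]; omega⟩
  have limU : Tendsto (fun m => groundEnergyAt (fermionTorusGraph 2 (φ m)) t U (rectN n (φ m)) /
      ((φ m : ℕ) : ℝ) ^ 2) atTop (𝓝 (energyDensity2D t U n)) :=
    (tendsto_energyDensity2D_torus t hU hn0 hn2).comp hφ
  have lim0 : Tendsto (fun m => groundEnergyAt (fermionTorusGraph 2 (φ m)) t 0 (rectN n (φ m)) /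
      ((φ m : ℕ) : ℝ) ^ 2) atTop (𝓝 (energyDensity2D t 0 n)) :=
    (tendsto_energyDensity2D_torus t le_rfl hn0 hn2).comp hφ
  have limN : Tendsto (fun m => ((rectN n (φ m) : ℕ) : ℝ) / ((φ m : ℕ) : ℝ) ^ 2) atTop (𝓝 n) :=
    (tendsto_rectN_div_sq hn0).comp hφ
  have limI : Tendsto (fun m => U * ((((rectN n (φ m) : ℕ) : ℝ) / ((φ m : ℕ) : ℝ) ^ 2) / 2) ^ 2)
      atTop (𝓝 (U * (n / 2) ^ 2)) :=
    ((limN.div_const 2).pow 2).const_mul U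
  refine le_of_tendsto_of_tendsto' limU (lim0.add limI) fun m => ?_
  have hL3 : 3 ≤ φ m := by simp only [hφdef]; omega
  haveI : NeZero (φ m) := ⟨by omega⟩
  set M : ℕ := ⌊n * ((φ m : ℕ) : ℝ) ^ 2 / 2⌋₊ with hMdef
  have hr : rectN n (φ m) = 2 * M := rfl
  have hM : M ≤ Fintype.card (TorusSite 2 (φ m)) := by
    have h2 : rectN n (φ m) ≤ 2 * (φ m * φ m) := rectN_le_two_mul hn0 hn2.le (φ m)
    rw [hr] at h2
    have hc : Fintype.card (TorusSite 2 (φ m)) = φ m ^ 2 := by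
      rw [Fintype.card_fun, ZMod.card, Fintype.card_fin]
    rw [hc, sq]
    exact Nat.le_of_mul_le_mul_left h2 (by norm_num)
  have key := groundEnergyAt_le_free_add_interaction hL3 t U hM
  rw [← hr] at key
  have hL2 : (0 : ℝ) ≤ ((φ m : ℕ) : ℝ) ^ 2 := sq_nonneg _
  have hcast : ((rectN n (φ m) : ℕ) : ℝ) = 2 * (M : ℝ) := by rw [hr]; push_cast; ring
  rw [show U * ((((rectN n (φ m) : ℕ) : ℝ) / ((φ m : ℕ) : ℝ) ^ 2) / 2) ^ 2 =
      U * ((M : ℝ) * M) / ((φ m : ℕ) : ℝ) ^ 2 / ((φ m : ℕ) : ℝ) ^ 2 by rw [hcast]; ring]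
  rw [← add_div]
  exact div_le_div_of_nonneg_right key hL2

/-- Half filling: `e(t, U, 1) ≤ e(t, 0, 1) + U/4` for every real `t` and every `U ≥ 0`.
[cite: BachLiebSolovej1994, eq. (2c.36)] -/
theorem energyDensity2D_one_le_free_add (t : ℝ) {U : ℝ} (hU : 0 ≤ U) :
    energyDensity2D t U 1 ≤ energyDensity2D t 0 1 + U / 4 := by
  have h := energyDensity2D_le_free_add_interaction t hU zero_le_one one_lt_two
  have e : U * ((1 : ℝ) / 2) ^ 2 = U / 4 := by ring
  linarith

/-- The ceiling in closed form for every real `t`: `e(t, U, 1) ≤ -16|t|/π² + U/4`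
(`FreeFermionSquare.energyDensity2D_zero_one`). [cite: BachLiebSolovej1994, eq. (2c.36)]
[cite: Hirsch1985, §II, eq. (2.2)] -/
theorem energyDensity2D_one_le_hf (t : ℝ) {U : ℝ} (hU : 0 ≤ U) :
    energyDensity2D t U 1 ≤ -(16 * |t|) / Real.pi ^ 2 + U / 4 := by
  have h := energyDensity2D_one_le_free_add t hU
  rwa [FreeFermionSquare.energyDensity2D_zero_one] at h

/-- **THE HARTREE–FOCK CEILING at `t = 1`:** `e(1, U, 1) ≤ -16/π² + U/4` for every `U ≥ 0`.
[cite: BachLiebSolovej1994, eq. (2c.36)] [cite: Hirsch1985, §II, eq. (2.2)] -/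
theorem energyDensity2D_le_hf {U : ℝ} (hU : 0 ≤ U) :
    energyDensity2D 1 U 1 ≤ -16 / Real.pi ^ 2 + U / 4 := by
  have h := energyDensity2D_one_le_free_add 1 hU
  rwa [FreeFermionSquare.energyDensity2D_one_zero_one] at h

/-- The decidable-slot form: `e(1, U, 1) < -1.6211 + U/4` (`-16/π² < -1.6211`,
`FreeFermionSquare.energyDensity2D_one_zero_one_mem_Ioo`). [cite: Hirsch1985, §II, eq. (2.2)]
[cite: BachLiebSolovej1994, eq. (2c.36)] -/
theorem energyDensity2D_lt_hfSlot {U : ℝ} (hU : 0 ≤ U) :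
    energyDensity2D 1 U 1 < -1.6211 + U / 4 := by
  have h := energyDensity2D_le_hf hU
  have hw := FreeFermionSquare.energyDensity2D_one_zero_one_mem_Ioo
  rw [FreeFermionSquare.energyDensity2D_one_zero_one] at hw
  linarith [hw.2]

/-! ## §3 The M2 row faces: theorem ceiling and certificate-free envelope of every TL `e₀` cell -/

/-- **THEOREM CEILING (Hartree–Fock, certificate-free) at every `U ≥ 0`:** `M2EnergyUpperRow U hi` for
every rational slot `hi ≥ U/4 - 1.6211`.  Labelled "HF ceiling (thm)", never "certified".
[cite: BachLiebSolovej1994, eq. (2c.36)] [cite: Hirsch1985, §II, eq. (2.2)] -/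
theorem m2EnergyUpperRow_hf {U : ℝ} (hU : 0 ≤ U) {hi : ℚ} (h : U / 4 - 1.6211 ≤ ((hi : ℚ) : ℝ)) :
    M2EnergyUpperRow U hi := by
  unfold M2EnergyUpperRow
  linarith [energyDensity2D_lt_hfSlot hU]

/-- `U = 2`: `M2EnergyUpperRow 2 (-1.1211)` (certified ceiling of record `-1.1594207`, below it by `0.038`).
[cite: BachLiebSolovej1994, eq. (2c.36)] -/
theorem m2EnergyUpperRow_hf_two : M2EnergyUpperRow 2 (-1.1211 : ℚ) :=
  m2EnergyUpperRow_hf (by norm_num) (by norm_num)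

/-- `U = 4`: `M2EnergyUpperRow 4 (-0.6211)`. [cite: BachLiebSolovej1994, eq. (2c.36)] -/
theorem m2EnergyUpperRow_hf_four : M2EnergyUpperRow 4 (-0.6211 : ℚ) :=
  m2EnergyUpperRow_hf (by norm_num) (by norm_num)

/-- `U = 6`: `M2EnergyUpperRow 6 (-0.1211)`. [cite: BachLiebSolovej1994, eq. (2c.36)] -/
theorem m2EnergyUpperRow_hf_six : M2EnergyUpperRow 6 (-0.1211 : ℚ) :=
  m2EnergyUpperRow_hf (by norm_num) (by norm_num)

/-- `U = 8`: `M2EnergyUpperRow 8 (0.3789)`. [cite: BachLiebSolovej1994, eq. (2c.36)] -/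
theorem m2EnergyUpperRow_hf_eight : M2EnergyUpperRow 8 (0.3789 : ℚ) :=
  m2EnergyUpperRow_hf (by norm_num) (by norm_num)

/-- **The certificate-free two-sided ENVELOPE** (part 13's free floor + the Hartree–Fock ceiling):
`M2EnergyRow U lo hi` for every `U ≥ 0`, `lo ≤ -1.6212`, `hi ≥ U/4 - 1.6211`.
[cite: LiebLoss1993, §8, Theorem 8.2] [cite: BachLiebSolovej1994, eq. (2c.36)] -/
theorem m2EnergyRow_free_hf {U : ℝ} (hU : 0 ≤ U) {lo hi : ℚ} (hlo : lo ≤ -1.6212)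
    (hhi : U / 4 - 1.6211 ≤ ((hi : ℚ) : ℝ)) : M2EnergyRow U lo hi :=
  ⟨m2EnergyLowerRow_free_of_le hU hlo, m2EnergyUpperRow_hf hU hhi⟩

/-- `U = 2`: `M2EnergyRow 2 (-1.6212) (-1.1211)` (width `0.5001`; the M2 tolerance is `0.02`).
[cite: BachLiebSolovej1994, eq. (2c.36)] -/
theorem m2EnergyRow_envelope_two : M2EnergyRow 2 (-1.6212 : ℚ) (-1.1211 : ℚ) :=
  m2EnergyRow_free_hf (by norm_num) le_rfl (by norm_num)

/-- `U = 4`: `M2EnergyRow 4 (-1.6212) (-0.6211)`. [cite: BachLiebSolovej1994, eq. (2c.36)] -/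
theorem m2EnergyRow_envelope_four : M2EnergyRow 4 (-1.6212 : ℚ) (-0.6211 : ℚ) :=
  m2EnergyRow_free_hf (by norm_num) le_rfl (by norm_num)

/-- `U = 6`: `M2EnergyRow 6 (-1.6212) (-0.1211)`. [cite: BachLiebSolovej1994, eq. (2c.36)] -/
theorem m2EnergyRow_envelope_six : M2EnergyRow 6 (-1.6212 : ℚ) (-0.1211 : ℚ) :=
  m2EnergyRow_free_hf (by norm_num) le_rfl (by norm_num)

/-- `U = 8`: `M2EnergyRow 8 (-1.6212) (0.3789)`. [cite: BachLiebSolovej1994, eq. (2c.36)] -/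
theorem m2EnergyRow_envelope_eight : M2EnergyRow 8 (-1.6212 : ℚ) (0.3789 : ℚ) :=
  m2EnergyRow_free_hf (by norm_num) le_rfl (by norm_num)

/-! ## §4 Controls as refutations: a floor at or above the Hartree–Fock ceiling is false -/

/-- For `U ≥ 0`, a LOWER row strictly above `-16/π² + U/4` is false.
[cite: BachLiebSolovej1994, eq. (2c.36)] [cite: Hirsch1985, §II, eq. (2.2)] -/
theorem not_m2EnergyLowerRow_of_hf_lt {U : ℝ} (hU : 0 ≤ U) {lo : ℚ}
    (h : -16 / Real.pi ^ 2 + U / 4 < ((lo : ℚ) : ℝ)) : ¬ M2EnergyLowerRow U lo := by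
  intro hl
  unfold M2EnergyLowerRow at hl
  linarith [energyDensity2D_le_hf hU]

/-- Decidable-slot form (the table's control): for `U ≥ 0`, a LOWER row at a slot `lo ≥ U/4 - 1.6211` is
false — a certified floor there is a CONTRADICTION. [cite: BachLiebSolovej1994, eq. (2c.36)]
[cite: Hirsch1985, §II, eq. (2.2)] -/
theorem not_m2EnergyLowerRow_of_hfSlot_le {U : ℝ} (hU : 0 ≤ U) {lo : ℚ}
    (h : U / 4 - 1.6211 ≤ ((lo : ℚ) : ℝ)) : ¬ M2EnergyLowerRow U lo := by
  intro hl
  unfold M2EnergyLowerRow at hl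
  linarith [energyDensity2D_lt_hfSlot hU]

/-! ## §5 The `4 × 4` torus (T4 cells): `E₀(16) ≤ -24 + 4U` -/

/-- **Hartree–Fock ceiling on the `4 × 4` torus** at `t = 1`, `N = 16`, every real `U`:
`E₀ ≤ -24 + 4U` (§1 with `m = 8` and `E₀(U = 0) = -24`,
`FreeFermionTorus.hubbardTorus44_groundEnergyAt_one_zero_sixteen`).
[cite: BachLiebSolovej1994, eq. (2c.36)] [cite: LiebLoss1993, §8, Theorem 8.2] -/
theorem hubbardTorus44_groundEnergyAt_le_hf (U : ℝ) :
    groundEnergyAt (fermionTorusGraph 2 4) 1 U 16 ≤ -24 + 4 * U := by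
  haveI : NeZero (4 : ℕ) := ⟨by norm_num⟩
  have hM : 8 ≤ Fintype.card (TorusSite 2 4) := by
    rw [Fintype.card_fun, ZMod.card, Fintype.card_fin]; norm_num
  have key := groundEnergyAt_le_free_add_interaction (d := 2) (L := 4) (by norm_num) 1 U hM
  rw [show 2 * 8 = 16 from rfl, FreeFermionTorus.hubbardTorus44_groundEnergyAt_one_zero_sixteen] at key
  norm_num at key
  linarith

/-- T4, `U = 2`: `TorusEnergyUpperRow 4 2 (-16)` (per site `-1`). [cite: BachLiebSolovej1994, eq. (2c.36)] -/
theorem torusEnergyUpperRow_four_hf_two : TorusEnergyUpperRow 4 2 (-16 : ℚ) := by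
  unfold TorusEnergyUpperRow; norm_num; linarith [hubbardTorus44_groundEnergyAt_le_hf 2]

/-- T4, `U = 4`: `TorusEnergyUpperRow 4 4 (-8)` (per site `-1/2`). [cite: BachLiebSolovej1994, eq. (2c.36)] -/
theorem torusEnergyUpperRow_four_hf_four : TorusEnergyUpperRow 4 4 (-8 : ℚ) := by
  unfold TorusEnergyUpperRow; norm_num; linarith [hubbardTorus44_groundEnergyAt_le_hf 4]

/-- T4, `U = 6`: `TorusEnergyUpperRow 4 6 0` (per site `0`). [cite: BachLiebSolovej1994, eq. (2c.36)] -/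
theorem torusEnergyUpperRow_four_hf_six : TorusEnergyUpperRow 4 6 (0 : ℚ) := by
  unfold TorusEnergyUpperRow; norm_num; linarith [hubbardTorus44_groundEnergyAt_le_hf 6]

/-- T4, `U = 8`: `TorusEnergyUpperRow 4 8 8` (per site `1/2`). [cite: BachLiebSolovej1994, eq. (2c.36)] -/
theorem torusEnergyUpperRow_four_hf_eight : TorusEnergyUpperRow 4 8 (8 : ℚ) := by
  unfold TorusEnergyUpperRow; norm_num; linarith [hubbardTorus44_groundEnergyAt_le_hf 8]

end M2

end Summit.Ventures.CertifiedManyBodySolver
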